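import Summits.MatrixMultiplication.MatrixMultiplication.Theorems.LevelGradedCohnUmansGradedDesignFamilyStubSubfieldCellModPDuals

/-!
# Bridging lemmas for mod-`p` dual certificates in the subfield cell (cheap, compiled hypothesis forms)

Route `LevelGradedCohnUmans`, crux `GradedDesignFamily` (stmt-MatrixMultiplication-7610), registered line
`Cruxes/GradedDesignFamily/Lines/quadratic_extension_level_one_cell.lean`, stub S3 `stub_subfieldCell`
(the "subfield cell" `GL₂(𝔽_{q²}) ⊃ SL₂(𝔽_q)`).

HONEST FRAMING.  Pure bookkeeping in support of compiler-checked FINITE instances of the stub's inner clause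
(certificates); it decides nothing about the asymptotic stub and is NOT summit progress.

The packaging lemma `subfieldCell_pack_modp` (module `…StubSubfieldCellModPDuals`) takes, per coset
representative `r_c`, the dual identities `∑_{u ∈ S} b_c u ((φ(h) r_c') u) = [φ(h) r_c' = r_c]` stated over the
UNIT `mapGL K h * r_c'` with `let`-bound entries (hypothesis `hdual`), and a target well-formedness hypothesis
`hwf` quantified over all of `SL₂(k) × Y × Y × Z × Z`.  Both are what `native_decide` has to EVALUATE, and at
`|K| = 25` (`|SL₂(𝔽₅)| = 120`, 98 cosets, 11 760 points per identity, designs `10 × 10`) the cost matters.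
Measured on the Lean farm (this cell, gen 7): the `hdual` form costs ≈ 62 s per coset representative — the
`let`s of a bare proposition do not survive instance resolution (`Decidable (let x := e; P x)` is found for
`P e`), so the four entries of the point matrix are recomputed inside every one of the 26 frame terms through
the generic matrix product.  Hence:

* `modpDualResidual` — a compiled FUNCTION computing the residual
  `∑_{u ∈ S} b u (M u) - [M = R]` of one identity at one point from PLAIN MATRICES, binding the four entries of
  `M` once and writing the frame vectors `M u` out (`2` products each); ≈ 11 s per coset representative;
* `modpDual_matrixForm_of_residual`, `modpDual_point_of_matrixForm`, `modpDual_point_of_residual` — the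
  vanishing of the residual at `M = (h : Matrix).map (algebraMap k K) * ↑r`, `R = ↑r₀` gives the `hdual`-form
  identity at the unit `mapGL K h * r` (definitional unfolding, `Matrix.eta_fin_two`, `Units.ext_iff`);
* `subfieldCell_hwf_of_subfieldTest` — `hwf` follows from the much smaller SUBFIELD TEST
  "`z_j (y_i y_i'⁻¹ z_l)⁻¹` entrywise in (the image of) `k` ⇒ `y_i = y_i'` and `z_l = z_j`"
  (`|Y|²|Z|²` instead of `|SL₂(k)|·|Y|²|Z|²` cases): `φ(h) y_i y_i'⁻¹ z_l = z_j` forces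
  `z_j (y_i y_i'⁻¹ z_l)⁻¹ = φ(h)`, which passes any test passed by all of `algebraMap k K`, and then
  `φ(h) = 1`, `h = 1` by injectivity of `algebraMap k K`; `subfieldCell_hwf_of_subfieldDetTest` -- the same with
  `det = 1` added to the test (needed when some quotient lies in `GL₂(k) ∖ SL₂(k)`).
-/

namespace Summit.MatrixMultiplication.MatrixMultiplication.Theorems.GradedDesignFamily

open Matrix

/-- The RESIDUAL `∑_{u ∈ S} b u (M u) - [M = R]` of one mod-`p` dual identity at one point, as a compiled
function: the four entries of the point matrix `M` are bound ONCE, the frame vectors `M u` are written out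
(`2` products each) and the target test is entrywise (evaluation helper for `native_decide`d certificate blocks:
the `let`s of a bare proposition are destroyed by instance resolution, those of a `def` are not; certificate use
only, not summit progress). -/
def modpDualResidual {K : Type} [CommRing K] [DecidableEq K] {p : ℕ}
    (b : (Fin 2 → K) → (Fin 2 → K) → ZMod p) (S : Finset (Fin 2 → K)) (M R : Matrix (Fin 2) (Fin 2) K) :
    ZMod p :=
  let x₀₀ : K := M 0 0
  let x₀₁ : K := M 0 1
  let x₁₀ : K := M 1 0
  let x₁₁ : K := M 1 1
  (∑ u ∈ S, b u ![x₀₀ * u 0 + x₀₁ * u 1, x₁₀ * u 0 + x₁₁ * u 1]) -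
    (if x₀₀ = R 0 0 ∧ x₀₁ = R 0 1 ∧ x₁₀ = R 1 0 ∧ x₁₁ = R 1 1 then 1 else 0)

/-- `modpDualResidual b S M R = 0` is the dual identity `∑_{u ∈ S} b u (M u) = [M = R]`. -/
theorem modpDual_matrixForm_of_residual {K : Type} [CommRing K] [DecidableEq K] {p : ℕ}
    (b : (Fin 2 → K) → (Fin 2 → K) → ZMod p) (S : Finset (Fin 2 → K)) (M R : Matrix (Fin 2) (Fin 2) K)
    (h : modpDualResidual b S M R = 0) :
    (∑ u ∈ S, b u (M.mulVec u)) = if M = R then 1 else 0 := by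
  have hvec : ∀ u : Fin 2 → K, ![M 0 0 * u 0 + M 0 1 * u 1, M 1 0 * u 0 + M 1 1 * u 1] = M.mulVec u := by
    intro u; ext i; fin_cases i <;> simp [Matrix.mulVec, dotProduct, Fin.sum_univ_two]
  have hiff : (M 0 0 = R 0 0 ∧ M 0 1 = R 0 1 ∧ M 1 0 = R 1 0 ∧ M 1 1 = R 1 1) ↔ M = R := by
    constructor
    · rintro ⟨h1, h2, h3, h4⟩
      ext i j; fin_cases i <;> fin_cases j <;> assumption
    · intro e; simp [e]
  unfold modpDualResidual at h
  dsimp only at h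
  simp only [hvec] at h
  rw [sub_eq_zero] at h
  by_cases hc : M = R
  · rw [if_pos hc]; rw [if_pos (hiff.mpr hc)] at h; exact h
  · rw [if_neg hc]; rw [if_neg (fun h' => hc (hiff.mp h'))] at h; exact h

/-- Form conversion for ONE point of a mod-`p` dual identity: the statement on plain matrices
`(g : Matrix).map (algebraMap k K) * ↑r` gives the `let X := ↑(mapGL K g * r) …` form used by the
hypothesis `hdual` of `subfieldCell_pack_modp` (bookkeeping; certificate use only, not summit progress). -/
theorem modpDual_point_of_matrixForm {k K : Type} [CommRing k] [CommRing K] [DecidableEq K] [Algebra k K]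
    {p : ℕ} (S : Finset (Fin 2 → K)) (b : (Fin 2 → K) → (Fin 2 → K) → ZMod p)
    (g : Matrix.SpecialLinearGroup (Fin 2) k) (r r₀ : GL (Fin 2) K)
    (h : (∑ u ∈ S, b u ((((g : Matrix (Fin 2) (Fin 2) k).map (algebraMap k K)) *
            (r : Matrix (Fin 2) (Fin 2) K)).mulVec u)) =
          if ((g : Matrix (Fin 2) (Fin 2) k).map (algebraMap k K)) * (r : Matrix (Fin 2) (Fin 2) K) =
              (r₀ : Matrix (Fin 2) (Fin 2) K) then 1 else 0) :
    (let X : Matrix (Fin 2) (Fin 2) K :=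
        ((Matrix.SpecialLinearGroup.mapGL K g * r : GL (Fin 2) K) : Matrix (Fin 2) (Fin 2) K)
      let x₀₀ : K := X 0 0
      let x₀₁ : K := X 0 1
      let x₁₀ : K := X 1 0
      let x₁₁ : K := X 1 1
      ∑ u ∈ S, b u (!![x₀₀, x₀₁; x₁₀, x₁₁].mulVec u)) =
      if Matrix.SpecialLinearGroup.mapGL K g * r = r₀ then 1 else 0 := by
  have hX : ((Matrix.SpecialLinearGroup.mapGL K g * r : GL (Fin 2) K) : Matrix (Fin 2) (Fin 2) K) =
      ((g : Matrix (Fin 2) (Fin 2) k).map (algebraMap k K)) * (r : Matrix (Fin 2) (Fin 2) K) := by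
    rw [Units.val_mul, Matrix.SpecialLinearGroup.mapGL_coe_matrix]; rfl
  have hiff : Matrix.SpecialLinearGroup.mapGL K g * r = r₀ ↔
      ((g : Matrix (Fin 2) (Fin 2) k).map (algebraMap k K)) * (r : Matrix (Fin 2) (Fin 2) K) =
        (r₀ : Matrix (Fin 2) (Fin 2) K) := by
    rw [← hX]; exact Units.ext_iff
  dsimp only
  rw [← Matrix.eta_fin_two ((Matrix.SpecialLinearGroup.mapGL K g * r : GL (Fin 2) K) :
      Matrix (Fin 2) (Fin 2) K), hX]
  by_cases hc : Matrix.SpecialLinearGroup.mapGL K g * r = r₀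
  · rw [if_pos hc]; rw [if_pos (hiff.mp hc)] at h; exact h
  · rw [if_neg hc]; rw [if_neg (fun h' => hc (hiff.mpr h'))] at h; exact h

/-- The two conversions composed: a vanishing `modpDualResidual` at the point `φ(g)·r` (plain matrices) gives
the `hdual`-form identity of `subfieldCell_pack_modp` at that point. -/
theorem modpDual_point_of_residual {k K : Type} [CommRing k] [CommRing K] [DecidableEq K] [Algebra k K]
    {p : ℕ} (S : Finset (Fin 2 → K)) (b : (Fin 2 → K) → (Fin 2 → K) → ZMod p)
    (g : Matrix.SpecialLinearGroup (Fin 2) k) (r r₀ : GL (Fin 2) K)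
    (h : modpDualResidual b S (((g : Matrix (Fin 2) (Fin 2) k).map (algebraMap k K)) *
            (r : Matrix (Fin 2) (Fin 2) K)) (r₀ : Matrix (Fin 2) (Fin 2) K) = 0) :
    (let X : Matrix (Fin 2) (Fin 2) K :=
        ((Matrix.SpecialLinearGroup.mapGL K g * r : GL (Fin 2) K) : Matrix (Fin 2) (Fin 2) K)
      let x₀₀ : K := X 0 0
      let x₀₁ : K := X 0 1
      let x₁₀ : K := X 1 0
      let x₁₁ : K := X 1 1
      ∑ u ∈ S, b u (!![x₀₀, x₀₁; x₁₀, x₁₁].mulVec u)) =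
      if Matrix.SpecialLinearGroup.mapGL K g * r = r₀ then 1 else 0 :=
  modpDual_point_of_matrixForm S b g r r₀ (modpDual_matrixForm_of_residual b S _ _ h)

/-- Target well-formedness (hypothesis `hwf` of `subfieldCell_pack_modp`) from the SUBFIELD TEST: if every
`z_j (y_i y_i'⁻¹ z_l)⁻¹` whose four entries pass a test `test` passed by all of `algebraMap k K` has
`y_i = y_i'` and `z_l = z_j`, then `φ(h) y_i y_i'⁻¹ z_l = z_j` (with `φ = mapGL K`, `algebraMap k K` injective)
only for `h = 1`, `y_i = y_i'`, `z_l = z_j` (bookkeeping; certificate use only, not summit progress). -/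
theorem subfieldCell_hwf_of_subfieldTest {k K : Type} [CommRing k] [CommRing K] [Algebra k K]
    (hinjK : Function.Injective (algebraMap k K)) (test : K → Prop)
    (htest : ∀ x : k, test (algebraMap k K x))
    {ny nz m : ℕ} (yOf : Fin ny → GL (Fin 2) K) (zOf : Fin nz → GL (Fin 2) K)
    (slOf : Fin m → Matrix.SpecialLinearGroup (Fin 2) k)
    (h : ∀ i i' : Fin ny, ∀ l j : Fin nz,
      (∀ a b : Fin 2, test (((zOf j * (yOf i * (yOf i')⁻¹ * zOf l)⁻¹ : GL (Fin 2) K) :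
          Matrix (Fin 2) (Fin 2) K) a b)) →
      yOf i = yOf i' ∧ zOf l = zOf j) :
    ∀ n : Fin m, ∀ i i' : Fin ny, ∀ l j : Fin nz,
      Matrix.SpecialLinearGroup.mapGL K (slOf n) * yOf i * (yOf i')⁻¹ * zOf l = zOf j →
      slOf n = 1 ∧ yOf i = yOf i' ∧ zOf l = zOf j := by
  intro n i i' l j hEq
  have hinj : Function.Injective (Matrix.SpecialLinearGroup.mapGL (n := Fin 2) (R := k) K) := by
    intro a a' hh
    have h' := congrArg (fun w : GL (Fin 2) K => (w : Matrix (Fin 2) (Fin 2) K)) hh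
    simp only [Matrix.SpecialLinearGroup.mapGL_coe_matrix] at h'
    exact Subtype.ext (Matrix.map_injective hinjK h')
  have hT : zOf j * (yOf i * (yOf i')⁻¹ * zOf l)⁻¹ = Matrix.SpecialLinearGroup.mapGL K (slOf n) := by
    rw [← hEq]; group
  have hentry : ∀ a b : Fin 2,
      ((Matrix.SpecialLinearGroup.mapGL K (slOf n) : GL (Fin 2) K) : Matrix (Fin 2) (Fin 2) K) a b =
        algebraMap k K ((slOf n : Matrix (Fin 2) (Fin 2) k) a b) := fun a b => rfl
  have him : ∀ a b : Fin 2, test (((zOf j * (yOf i * (yOf i')⁻¹ * zOf l)⁻¹ : GL (Fin 2) K) :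
      Matrix (Fin 2) (Fin 2) K) a b) := by
    intro a b
    rw [hT, hentry]
    exact htest _
  obtain ⟨hy, hz⟩ := h i i' l j him
  refine ⟨?_, hy, hz⟩
  rw [hy, hz, mul_inv_cancel_right] at hEq
  have h1 : Matrix.SpecialLinearGroup.mapGL K (slOf n) = 1 := by
    simpa using congrArg (· * (zOf j)⁻¹) hEq
  exact hinj (h1.trans (map_one _).symm)

/-- The same with the DETERMINANT in the test (designs whose quotients `z_j (y_i y_i'⁻¹ z_l)⁻¹` meet
`GL₂(k) ∖ SL₂(k)` fail the plain subfield test but pass this one): if every `z_j (y_i y_i'⁻¹ z_l)⁻¹` of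
determinant `1` whose four entries pass `test` has `y_i = y_i'` and `z_l = z_j`, then `hwf` holds
(bookkeeping; certificate use only, not summit progress). -/
theorem subfieldCell_hwf_of_subfieldDetTest {k K : Type} [CommRing k] [CommRing K] [Algebra k K]
    (hinjK : Function.Injective (algebraMap k K)) (test : K → Prop)
    (htest : ∀ x : k, test (algebraMap k K x))
    {ny nz m : ℕ} (yOf : Fin ny → GL (Fin 2) K) (zOf : Fin nz → GL (Fin 2) K)
    (slOf : Fin m → Matrix.SpecialLinearGroup (Fin 2) k)
    (h : ∀ i i' : Fin ny, ∀ l j : Fin nz,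
      (∀ a b : Fin 2, test (((zOf j * (yOf i * (yOf i')⁻¹ * zOf l)⁻¹ : GL (Fin 2) K) :
          Matrix (Fin 2) (Fin 2) K) a b)) →
      Matrix.det (((zOf j * (yOf i * (yOf i')⁻¹ * zOf l)⁻¹ : GL (Fin 2) K) : Matrix (Fin 2) (Fin 2) K)) = 1 →
      yOf i = yOf i' ∧ zOf l = zOf j) :
    ∀ n : Fin m, ∀ i i' : Fin ny, ∀ l j : Fin nz,
      Matrix.SpecialLinearGroup.mapGL K (slOf n) * yOf i * (yOf i')⁻¹ * zOf l = zOf j →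
      slOf n = 1 ∧ yOf i = yOf i' ∧ zOf l = zOf j := by
  intro n i i' l j hEq
  have hinj : Function.Injective (Matrix.SpecialLinearGroup.mapGL (n := Fin 2) (R := k) K) := by
    intro a a' hh
    have h' := congrArg (fun w : GL (Fin 2) K => (w : Matrix (Fin 2) (Fin 2) K)) hh
    simp only [Matrix.SpecialLinearGroup.mapGL_coe_matrix] at h'
    exact Subtype.ext (Matrix.map_injective hinjK h')
  have hT : zOf j * (yOf i * (yOf i')⁻¹ * zOf l)⁻¹ = Matrix.SpecialLinearGroup.mapGL K (slOf n) := by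
    rw [← hEq]; group
  have hentry : ∀ a b : Fin 2,
      ((Matrix.SpecialLinearGroup.mapGL K (slOf n) : GL (Fin 2) K) : Matrix (Fin 2) (Fin 2) K) a b =
        algebraMap k K ((slOf n : Matrix (Fin 2) (Fin 2) k) a b) := fun a b => rfl
  have him : ∀ a b : Fin 2, test (((zOf j * (yOf i * (yOf i')⁻¹ * zOf l)⁻¹ : GL (Fin 2) K) :
      Matrix (Fin 2) (Fin 2) K) a b) := by
    intro a b
    rw [hT, hentry]
    exact htest _
  have hdet : Matrix.det (((zOf j * (yOf i * (yOf i')⁻¹ * zOf l)⁻¹ : GL (Fin 2) K) :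
      Matrix (Fin 2) (Fin 2) K)) = 1 := by
    rw [hT, Matrix.SpecialLinearGroup.mapGL_coe_matrix]
    exact Matrix.SpecialLinearGroup.det_coe _
  obtain ⟨hy, hz⟩ := h i i' l j him hdet
  refine ⟨?_, hy, hz⟩
  rw [hy, hz, mul_inv_cancel_right] at hEq
  have h1 : Matrix.SpecialLinearGroup.mapGL K (slOf n) = 1 := by
    simpa using congrArg (· * (zOf j)⁻¹) hEq
  exact hinj (h1.trans (map_one _).symm)

end Summit.MatrixMultiplication.MatrixMultiplication.Theorems.GradedDesignFamily
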